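import Summits.RiemannHypothesis.RiemannHypothesis.Theorems.DBNDbnThesis
import Literature.NumberTheory.LFunctions.EquivalentsHolds
import HarnessLib

/-!
# RiemannHypothesis / DBN — the assembly item `DBN.Assembly` (stmt-RiemannHypothesis-0276) closed

LINE 1 — LABEL: `DBN.Assembly` is the **RH-FREE** implication «X → RH», where X = `DBN.DbnThesis`
(`H_t` has only real zeros for every `t > 0`, i.e. `Λ ≤ 0` in `sInf`-free form) is the route-DBN
target and is itself **RH-EQUIVALENT** (`dbnThesis_iff_summit`, `Theorems/DBNDbnThesis.lean`).
bears_on: N-C/N-P (LADDER-RH §1, COLUMN 3 DBN; the «IsolatedDBN → RiemannHypothesis» kernel glue of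
the C3 cell `rh-crit/rt`, seat rt-iso).  WHAT THIS IS NOT: an implication out of an RH-equivalent
hypothesis is not evidence for its hypothesis; closing this item proves de Bruijn 1950 / Newman 1976
bookkeeping, not X, and moves neither crux `DbnHighUniform` / `DbnLowAllT`; nothing here bears on
the truth of RH.

* `dbnAssembly_proof : DBN.Assembly` — proved EXACTLY along the item's informal text, every step a
  tree THEOREM (no named-fact hypothesis): X gives `Λ ≤ 0` by
  `deBruijnNewmanConst_le_iff_holds 0` (Newman's `sInf`-free characterisation at `t = 0`); Newman
  closedness `hasOnlyRealZeros_deBruijnH_iff_deBruijnNewmanConst_le_holds 0` (Hurwitz) gives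
  `HasOnlyRealZeros (deBruijnH 0)`; then RH by
  `riemannHypothesis_iff_hasOnlyRealZeros_deBruijnH_zero_holds` (`H_0 = ξ(½ + iz/2)/8`), and the
  summit is definitionally Mathlib's `RiemannHypothesis` (`Summit.RiemannHypothesis_iff`).
  (Equivalently `fun h ↦ dbnThesis_iff_summit.mp h`, `Theorems/DBNDbnThesis.lean`.)
* Zero-margin forms with the Rodgers–Tao theorem `Λ ≥ 0` DISCHARGED (the tree's
  `rodgers_tao_holds` / `deBruijnNewmanConst_nonneg_holds`, proved along Dobner 2021), removing the
  `(hRT : rodgers_tao)` binders of `Theorems/DBNDbnThesis.lean`: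
  `deBruijnNewmanConst_eq_zero_of_dbnThesis` (X → `Λ = 0`: `≤` from X via
  `deBruijnNewmanConst_le_iff_holds 0`, `≥` is `Λ ≥ 0`),
  `dbnThesis_iff_deBruijnNewmanConst_eq_zero_holds` (X ↔ `Λ = 0`),
  `dbnThesis_iff_of_rodgers_tao_holds` (X ↔ `H_t` real-rooted exactly for `t ≥ 0`),
  `summit_iff_deBruijnNewmanConst_eq_zero` (`Summit.RiemannHypothesis ↔ Λ = 0`), and the item
  re-derived through them, `dbnAssembly_proof'` (X ⟹ `Λ = 0` ⟹ RH).

Theorems only; `--workitem stmt-RiemannHypothesis-0276`.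

References: N. G. de Bruijn, Duke Math. J. 17 (1950), Thm. 13; C. M. Newman, Proc. AMS 61 (1976),
Thm. 3 and Remark 2; B. Rodgers, T. Tao, Forum Math. Pi 8 (2020) e6, §1 and Thm. 1.1;
A. Dobner, Acta Arith. 201 (2021), Thm. 2.
-/

noncomputable section

-- D-0017: `Summit.<S>.<S>.…` is the designed namespace of a single-problem summit.
set_option linter.dupNamespace false

namespace Summit.RiemannHypothesis.RiemannHypothesis.Theorems

open Literature.NumberTheory.LFunctions
open Summit.RiemannHypothesis.RiemannHypothesis.Theses

/-! ## The item: X → `Summit.RiemannHypothesis` -/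

/-- **Item stmt-RiemannHypothesis-0276 (`DBN.Assembly`)**: if `H_t` has only real zeros for every
`t > 0` then the Riemann Hypothesis holds.  Proof along the item's informal text: X ⟹ `Λ ≤ 0`
(`deBruijnNewmanConst_le_iff_holds 0`) ⟹ `H_0` real-rooted (Newman closedness,
`hasOnlyRealZeros_deBruijnH_iff_deBruijnNewmanConst_le_holds 0`) ⟹ RH
(`riemannHypothesis_iff_hasOnlyRealZeros_deBruijnH_zero_holds`) = the summit
(`Summit.RiemannHypothesis_iff`).  RH-FREE implication; its hypothesis X is RH-EQUIVALENT.
[folklore] -/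
theorem dbnAssembly_proof : DBN.Assembly := by
  unfold DBN.Assembly
  intro hX
  -- Step 1 (Newman's `sInf`-free characterisation at `t = 0`): `Λ ≤ 0`.
  have hΛ : deBruijnNewmanConst ≤ 0 := (deBruijnNewmanConst_le_iff_holds 0).2 hX
  -- Step 2 (closedness of `{t | H_t real-rooted}`, Hurwitz): `H_0` has only real zeros.
  have h0 : HasOnlyRealZeros (deBruijnH 0) :=
    (hasOnlyRealZeros_deBruijnH_iff_deBruijnNewmanConst_le_holds 0).2 hΛ
  -- Step 3 (`H_0 = ξ(½ + iz/2)/8`): RH, which is the summit statement by definition.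
  exact Summit.RiemannHypothesis_iff.2 (riemannHypothesis_iff_hasOnlyRealZeros_deBruijnH_zero_holds.2 h0)

/-! ## Zero-margin forms, with Rodgers–Tao `Λ ≥ 0` discharged by the tree's theorem -/

/-- **X ⟹ `Λ = 0`**: `Λ ≤ 0` from X (`deBruijnNewmanConst_le_iff_holds 0`) and `Λ ≥ 0`
(Rodgers–Tao 2020 Thm. 1.1, the tree's THEOREM `deBruijnNewmanConst_nonneg_holds`, proved along
Dobner 2021).  The «`Λ ≥ 0` (theorem) ∧ X» glue of column DBN; X is RH-EQUIVALENT, so this is not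
evidence for `Λ = 0`. [folklore] -/
theorem deBruijnNewmanConst_eq_zero_of_dbnThesis (hX : DBN.DbnThesis) : deBruijnNewmanConst = 0 :=
  le_antisymm ((deBruijnNewmanConst_le_iff_holds 0).2 hX) deBruijnNewmanConst_nonneg_holds

/-- **X ↔ `Λ = 0`**, hypothesis-free: `dbnThesis_iff_deBruijnNewmanConst_eq_zero` of
`Theorems/DBNDbnThesis.lean` with its `rodgers_tao` binder discharged by `rodgers_tao_holds`.
[folklore] -/
theorem dbnThesis_iff_deBruijnNewmanConst_eq_zero_holds : DBN.DbnThesis ↔ deBruijnNewmanConst = 0 :=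
  dbnThesis_iff_deBruijnNewmanConst_eq_zero rodgers_tao_holds

/-- **X ↔ "`H_t` is real-rooted exactly for `t ≥ 0`"** ("if RH is true, it is barely so"),
hypothesis-free: `dbnThesis_iff_of_rodgers_tao` with `rodgers_tao_holds`. [folklore] -/
theorem dbnThesis_iff_of_rodgers_tao_holds :
    DBN.DbnThesis ↔ ∀ t : ℝ, HasOnlyRealZeros (deBruijnH t) ↔ 0 ≤ t :=
  dbnThesis_iff_of_rodgers_tao rodgers_tao_holds

/-- **`Summit.RiemannHypothesis ↔ Λ = 0`**, hypothesis-free (the tree's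
`riemannHypothesis_iff_deBruijnNewmanConst_eq_zero`, `EquivalentsHolds.lean`, under the summit's
name).  An equivalence is not a proof; nothing here bears on the truth of RH. [folklore] -/
theorem summit_iff_deBruijnNewmanConst_eq_zero : Summit.RiemannHypothesis ↔ deBruijnNewmanConst = 0 :=
  Summit.RiemannHypothesis_iff.trans riemannHypothesis_iff_deBruijnNewmanConst_eq_zero

/-- The item once more through the zero-margin route «`Λ ≥ 0` (theorem) ∧ X ⟹ `Λ = 0` ⟹ RH»
(`deBruijnNewmanConst_eq_zero_of_dbnThesis`, `summit_iff_deBruijnNewmanConst_eq_zero`); the same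
`Prop` as `dbnAssembly_proof`, recorded for the column-DBN bookkeeping. [folklore] -/
theorem dbnAssembly_proof' : DBN.Assembly := by
  unfold DBN.Assembly
  intro hX
  exact summit_iff_deBruijnNewmanConst_eq_zero.2 (deBruijnNewmanConst_eq_zero_of_dbnThesis hX)

end Summit.RiemannHypothesis.RiemannHypothesis.Theorems

end
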